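import Summits.HodgeConjecture.HodgeConjecture.Theorems.Ring2AbelianAllAndreBaseChangePencilsNodes
import Summits.HodgeConjecture.HodgeConjecture.Theorems.Ring2AbelianAllAndreIsogenousPencils
import Summits.HodgeConjecture.HodgeConjecture.Theorems.Ring2AbelianAllAndreRetractPencils
import Summits.HodgeConjecture.HodgeConjecture.Theorems.Ring2AbelianAllAndreFibreProductPencils
import Summits.HodgeConjecture.HodgeConjecture.Theorems.Ring2AbelianAllAndreProductPencilsNodes
import Summits.HodgeConjecture.HodgeConjecture.Theorems.Ring2AbelianAllAndreTransportLattice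
import HarnessLib

/-!
# Ring 2 · sub-cell AbelianAll (ALL ABELIAN VARIETIES), André axis, part XXXV-f — ABDULALI'S TRANSPORT `(1.1)_f` BY NAME UNDER
# THE FOUR FUNCTORIALITIES: `InvariantCyclesHoldFor f d` (Abdulali 1994 (1.1) for ONE compact pencil: a flat family of rational
# `(p,p)`-classes algebraic at one fibre is algebraic at every fibre) is INVARIANT under fibrewise isogenies and DESCENDS along
# connected finite étale base change, along `S`-retracts (padding `B × 𝒳`, fibre products, fibre squares). FACT-FREE

HONEST FRAMING (page 1, verbatim): **research route, not a corollary; conditional on HC_CM plus one named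
minimal statement.** Cell line: research route conditional on HC_CM; not a corollary; Q11.4-sentence-2 already
refuted in dim ≥ 3. Nothing in this file proves a case of the Hodge conjecture for an abelian variety; `HC_CM`, `HC_AV`
do not occur; no node is born (0 `def`), no named fact is used, no `sorry`; axioms standard; nothing is claimed minimal.

## What this part does

Parts XXXII–XXXV proved the functorialities of the André axis in LATTICE form (`(j_t^*)⁻¹ N^p(X_t) ≤ (j_s^*)⁻¹ N^p(X_s)`,
`… ≤ N^p(𝒳) ⊔ ker j_t^*`). The one PER-PENCIL NAMED predicate of the axis in the tree is Abdulali's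
`Literature.AlgebraicGeometry.Abdulali1994.InvariantCyclesHoldFor f d` — the `W`-premised transport statement (1.1) for the
pencil `f` (premise: rational and of type `(p,p)` on every fibre), whose universal closure over CM-pointed pencils is the node (4);
part XVII (`invariantCyclesHoldFor_iff_comap_eq`) showed that on a compact abelian pencil it is EQUIVALENT to the premise-free
lattice form «`(j_s^*)⁻¹ N^p(X_s)` does not depend on `s`». This file records (1.1)_f BY NAME under the functorialities:

* §1 `invariantCyclesHoldFor_iff_forall_comap_le` — (1.1)_f ⟺ `∀ p t s, (j_t^*)⁻¹ N^p(X_t) ≤ (j_s^*)⁻¹ N^p(X_s)`.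
* §2 **`invariantCyclesHoldFor_iff_of_surjective`** — ISOGENIES: for a surjective `S`-morphism `ψ` of compact abelian pencils of
  the same relative dimension, `InvariantCyclesHoldFor (ψ ≫ f') d ↔ InvariantCyclesHoldFor f' d` (part XXXIV-a, both directions,
  surjectivity only).
* §3 **`invariantCyclesHoldFor_of_baseChange`** — FINITE ÉTALE BASE CHANGE (connected cover): (1.1) for `𝒳 ×_S S' ⟶ S'` gives
  (1.1) for `f` (part XXXV-d); `comap_le_comap_baseChange_of_forall_exists` — transport ASCENDS when the cover creates no new invariant
  classes at the source point; `finrank_range_le_of_finrank_range_le` — that hypothesis, in rank form, propagates from one point of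
  `S'` to all (point-independent kernels, rank–nullity); **`invariantCyclesHoldFor_iff_of_baseChange_of_finrank_range_le`** — (1.1) is
  INVARIANT under base changes with `dim Im j'^*_{t'} ≤ dim Im j^*_{g(t')}` at one point `t'` (all even degrees).
* §4 **`invariantCyclesHoldFor_of_retract`** — `S`-RETRACTS `𝒳 ⟶σ 𝒴 ⟶π 𝒳`: (1.1) for `π ≫ f` (abelian `(r+d)`-folds) gives (1.1)
  for `f` (part XXXIII-a); instances `invariantCyclesHoldFor_of_snd_comp` (padding `B × 𝒳`, part XXXII),
  `invariantCyclesHoldFor_of_fibreProduct` (`𝒴 ×_S 𝒳`, part XXXIII-b), `invariantCyclesHoldFor_of_square` (`𝒳 ×_S 𝒳`).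

What is NOT claimed: ascent along base change without the rank hypothesis, or along retracts (more invariant classes / more degrees upstairs); anything for
the `W`-premised bodies of (L)/(L∀) beyond what parts XVII/XXX record; anything minimal; any case of HC; any node-level statement
(node (4) quantifies over all CM-pointed pencils and gains nothing). EDGE LABELS: every row K (kernel, fact-free).

References: Abdulali1994FamiliesAV ((1.1) p. 1122, Conj. 5.3); Andre1996Motifs (§5.3 p. 30; §6.3 proof of Lemme 6.3.1 p. 32);
CharlesSchnell2014Notes ((11.3.1), Cor. 11.3.6); VoisinHodgeI2002 (§7.3.2 Remark 7.29); Fulton1998 (Prop. 1.7, Thm. 6.2 (a));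
MumfordGIT (Thm. 6.14); SGA1 (XII Prop. 2.4).
-/

noncomputable section

set_option linter.dupNamespace false

namespace Summit.HodgeConjecture.HodgeConjecture.Ring2.AbelianAll

open CategoryTheory CategoryTheory.Limits AlgebraicGeometry MonoidalCategory CartesianMonoidalCategory
open Literature.AlgebraicGeometry Literature.AlgebraicGeometry.Motives
open Literature.AlgebraicGeometry.HodgeTheory
open Literature.AlgebraicGeometry.Abdulali1994 (InvariantCyclesHoldFor)
open Summit.HodgeConjecture.HodgeConjecture.Theorems (isCompactAbelianPencil_familyPullback_snd)

variable {𝒳 𝒳' 𝒴 S S' : SchemeOver ℂ} {d : ℕ}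

/-! ## §1 (1.1)_f in the `≤` lattice form -/

/-- **(1.1)_f ⟺ `∀ p t s, (j_t^*)⁻¹ N^p(X_t) ≤ (j_s^*)⁻¹ N^p(X_s)`** on a compact pencil of abelian varieties (part XVII's
`invariantCyclesHoldFor_iff_comap_eq`, with the equalities read as two inequalities). [cite: Abdulali1994FamiliesAV, (1.1) (p. 1122)]
[cite: CharlesSchnell2014Notes, (11.3.1)] -/
theorem invariantCyclesHoldFor_iff_forall_comap_le {f : 𝒳 ⟶ S} (hf : IsCompactAbelianPencil f d) :
    InvariantCyclesHoldFor f d ↔ ∀ (p : ℕ) (t s : ComplexPoints S),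
      (algebraicClasses (fiberOver f t) p).comap (complexBetti.map (fiberι f t) (2 * p)).hom ≤
        (algebraicClasses (fiberOver f s) p).comap (complexBetti.map (fiberι f s) (2 * p)).hom := by
  rw [invariantCyclesHoldFor_iff_comap_eq hf]
  exact ⟨fun h p t s ↦ (h p t s).le, fun h p s s' ↦ le_antisymm (h p s s') (h p s' s)⟩

/-! ## §2 Isogenies -/

/-- **(1.1)_f IS AN INVARIANT OF THE `S`-ISOGENY CLASS OF THE PENCIL**: for a surjective `S`-morphism `ψ : 𝒳 ⟶ 𝒳'` of compact
pencils of abelian varieties of the same relative dimension, `InvariantCyclesHoldFor (ψ ≫ f') d ↔ InvariantCyclesHoldFor f' d`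
(part XXXIV-a `forall_comap_le_comap_iff_of_isogenous`). FACT-FREE. [cite: Abdulali1994FamiliesAV, (1.1) (p. 1122)]
[cite: Andre1996Motifs, §6.3 proof of Lemme 6.3.1 (p. 32)] [cite: VoisinHodgeI2002, §7.3.2 Remark 7.29] -/
theorem invariantCyclesHoldFor_iff_of_surjective {f' : 𝒳' ⟶ S} {ψ : 𝒳 ⟶ 𝒳'} (hf : IsCompactAbelianPencil (ψ ≫ f') d)
    (hf' : IsCompactAbelianPencil f' d) [Surjective ψ.left] :
    InvariantCyclesHoldFor (ψ ≫ f') d ↔ InvariantCyclesHoldFor f' d := by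
  rw [invariantCyclesHoldFor_iff_forall_comap_le hf, invariantCyclesHoldFor_iff_forall_comap_le hf']
  exact forall_congr' fun p ↦ forall_comap_le_comap_iff_of_isogenous hf hf' p

/-! ## §3 Finite étale base change -/

/-- **(1.1) DESCENDS ALONG CONNECTED FINITE ÉTALE BASE CHANGE**: (1.1) for the pulled-back pencil `𝒳 ×_S S' ⟶ S'` gives (1.1)
for `f` (part XXXV-d `forall_comap_le_comap_of_baseChange`). FACT-FREE. [cite: Abdulali1994FamiliesAV, (1.1) (p. 1122)]
[cite: Andre1996Motifs, §5.3 (p. 30)] [cite: SGA1, Exp. XII Prop. 2.4] -/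
theorem invariantCyclesHoldFor_of_baseChange {f : 𝒳 ⟶ S} (hf : IsCompactAbelianPencil f d) (g : S' ⟶ S) [IsFinite g.left]
    [Etale g.left] [ConnectedSpace (ComplexPoints S')] (h : InvariantCyclesHoldFor (familyPullback.snd f g) d) :
    InvariantCyclesHoldFor f d := by
  rw [invariantCyclesHoldFor_iff_forall_comap_le hf]
  rw [invariantCyclesHoldFor_iff_forall_comap_le (isCompactAbelianPencil_familyPullback_snd hf g)] at h
  exact fun p t s ↦ forall_comap_le_comap_of_baseChange hf g p (h p) t s

/-- **TRANSPORT ASCENDS when the cover creates no new invariant classes at the source point `t'`** (hypothesis `hinv` of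
part XXXV-d §3): transport `g(t') → g(s')` along `f` gives transport `t' → s'` along the pulled-back pencil — `W' ≡ G^* W` on the
fibre over `t'`, hence on EVERY fibre (`ker j'^*_{t'} = ker j'^*_{s'}`, part XVII for the pulled-back pencil), and `G^* W` transports
because `W` does (the fibres agree). FACT-FREE. [cite: Abdulali1994FamiliesAV, (1.1) (p. 1122)] [cite: Andre1996Motifs, §5.3 (p. 30)] -/
theorem comap_le_comap_baseChange_of_forall_exists {f : 𝒳 ⟶ S} (hf : IsCompactAbelianPencil f d) (g : S' ⟶ S)
    [IsFinite g.left] [Etale g.left] [ConnectedSpace (ComplexPoints S')] {p : ℕ} (t' s' : ComplexPoints S')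
    (hinv : ∀ W' : complexBetti (familyPullback f g) (2 * p), ∃ W : complexBetti 𝒳 (2 * p),
      complexBetti.map (fiberι (familyPullback.snd f g) t') (2 * p) W' =
        complexBetti.map (fiberι (familyPullback.snd f g) t') (2 * p) (complexBetti.map (familyPullback.fst f g) (2 * p) W))
    (h : (algebraicClasses (fiberOver f (AlgPoints.map g t')) p).comap (complexBetti.map (fiberι f (AlgPoints.map g t')) (2 * p)).hom ≤
      (algebraicClasses (fiberOver f (AlgPoints.map g s')) p).comap (complexBetti.map (fiberι f (AlgPoints.map g s')) (2 * p)).hom) :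
    (algebraicClasses (fiberOver (familyPullback.snd f g) t') p).comap
        (complexBetti.map (fiberι (familyPullback.snd f g) t') (2 * p)).hom ≤
      (algebraicClasses (fiberOver (familyPullback.snd f g) s') p).comap
        (complexBetti.map (fiberι (familyPullback.snd f g) s') (2 * p)).hom := by
  have hf' := isCompactAbelianPencil_familyPullback_snd hf g
  intro W' hW'
  have hW'₀ : complexBetti.map (fiberι (familyPullback.snd f g) t') (2 * p) W' ∈
      algebraicClasses (fiberOver (familyPullback.snd f g) t') p := hW'
  obtain ⟨W, hWW'⟩ := hinv W'
  have h₁ : complexBetti.map (fiberι f (AlgPoints.map g t')) (2 * p) W ∈ algebraicClasses (fiberOver f (AlgPoints.map g t')) p := by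
    rw [← map_fiberι_map_fst_mem_iff g p t' W, ← hWW']
    exact hW'₀
  have h₂ : complexBetti.map (fiberι f (AlgPoints.map g s')) (2 * p) W ∈ algebraicClasses (fiberOver f (AlgPoints.map g s')) p :=
    h h₁
  have h₃ := (map_fiberι_map_fst_mem_iff g p s' W).2 h₂
  -- `W' - G^* W` dies on the fibre over `t'`, hence over `s'`
  have hker : W' - complexBetti.map (familyPullback.fst f g) (2 * p) W ∈
      LinearMap.ker (complexBetti.map (fiberι (familyPullback.snd f g) s') (2 * p)).hom := by
    rw [ker_map_fiberι_eq hf' (2 * p) s' t', LinearMap.mem_ker]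
    change complexBetti.map (fiberι (familyPullback.snd f g) t') (2 * p)
      (W' - complexBetti.map (familyPullback.fst f g) (2 * p) W) = 0
    rw [map_sub, hWW', sub_self]
  rw [LinearMap.mem_ker, map_sub, sub_eq_zero] at hker
  change complexBetti.map (fiberι (familyPullback.snd f g) s') (2 * p) W' ∈ algebraicClasses (fiberOver (familyPullback.snd f g) s') p
  have hker' : complexBetti.map (fiberι (familyPullback.snd f g) s') (2 * p) W' =
      complexBetti.map (fiberι (familyPullback.snd f g) s') (2 * p) (complexBetti.map (familyPullback.fst f g) (2 * p) W) := hker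
  rw [hker']
  exact h₃

/-- **The no-new-invariants hypothesis propagates along the base**: if `dim Im j'^*_{t'} ≤ dim Im j^*_{g(t')}` in degree `k` at ONE
point `t'`, then at EVERY point `t''` (the kernels of the fibre restrictions do not depend on the point, part XVII, upstairs and
downstairs; rank–nullity). [cite: DeligneHodgeII1971, Thm. 4.1.1] [cite: VoisinHodgeII2003, §4.3.1 Thm. 4.18] -/
theorem finrank_range_le_of_finrank_range_le {f : 𝒳 ⟶ S} (hf : IsCompactAbelianPencil f d) (g : S' ⟶ S) [IsFinite g.left]
    [Etale g.left] [ConnectedSpace (ComplexPoints S')] {k : ℕ} {t' : ComplexPoints S'}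
    (hle : Module.finrank ℂ ↥(LinearMap.range (complexBetti.map (fiberι (familyPullback.snd f g) t') k).hom) ≤
      Module.finrank ℂ ↥(LinearMap.range (complexBetti.map (fiberι f (AlgPoints.map g t')) k).hom))
    (t'' : ComplexPoints S') :
    Module.finrank ℂ ↥(LinearMap.range (complexBetti.map (fiberι (familyPullback.snd f g) t'') k).hom) ≤
      Module.finrank ℂ ↥(LinearMap.range (complexBetti.map (fiberι f (AlgPoints.map g t'')) k).hom) := by
  have hf' := isCompactAbelianPencil_familyPullback_snd hf g
  haveI : Module.Finite ℂ (complexBetti (familyPullback f g) k) := finite_complexBetti hf'.isSmoothProjective_total _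
  haveI : Module.Finite ℂ (complexBetti 𝒳 k) := finite_complexBetti hf.isSmoothProjective_total _
  have e₁ := LinearMap.finrank_range_add_finrank_ker (complexBetti.map (fiberι (familyPullback.snd f g) t') k).hom
  have e₂ := LinearMap.finrank_range_add_finrank_ker (complexBetti.map (fiberι (familyPullback.snd f g) t'') k).hom
  have e₃ := LinearMap.finrank_range_add_finrank_ker (complexBetti.map (fiberι f (AlgPoints.map g t')) k).hom
  have e₄ := LinearMap.finrank_range_add_finrank_ker (complexBetti.map (fiberι f (AlgPoints.map g t'')) k).hom
  rw [ker_map_fiberι_eq hf' k t' t''] at e₁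
  rw [ker_map_fiberι_eq hf k (AlgPoints.map g t') (AlgPoints.map g t'')] at e₃
  omega

/-- **(1.1) IS INVARIANT UNDER BASE CHANGES CREATING NO NEW INVARIANT CLASSES**: if at one point `t'` of the cover, in every even
degree, `dim Im j'^*_{t'} ≤ dim Im j^*_{g(t')}`, then `InvariantCyclesHoldFor (𝒳 ×_S S' ⟶ S') d ↔ InvariantCyclesHoldFor f d` (§3 descent;
ascent by `comap_le_comap_baseChange_of_forall_exists` with part XXXV-d's `forall_exists_of_finrank_range_le` at every point).
FACT-FREE. [cite: Abdulali1994FamiliesAV, (1.1) (p. 1122)] [cite: Andre1996Motifs, §5.3 (p. 30)] -/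
theorem invariantCyclesHoldFor_iff_of_baseChange_of_finrank_range_le {f : 𝒳 ⟶ S} (hf : IsCompactAbelianPencil f d)
    (g : S' ⟶ S) [IsFinite g.left] [Etale g.left] [ConnectedSpace (ComplexPoints S')] (t' : ComplexPoints S')
    (hle : ∀ p : ℕ, Module.finrank ℂ ↥(LinearMap.range (complexBetti.map (fiberι (familyPullback.snd f g) t') (2 * p)).hom) ≤
      Module.finrank ℂ ↥(LinearMap.range (complexBetti.map (fiberι f (AlgPoints.map g t')) (2 * p)).hom)) :
    InvariantCyclesHoldFor (familyPullback.snd f g) d ↔ InvariantCyclesHoldFor f d := by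
  refine ⟨invariantCyclesHoldFor_of_baseChange hf g, fun h ↦ ?_⟩
  rw [invariantCyclesHoldFor_iff_forall_comap_le (isCompactAbelianPencil_familyPullback_snd hf g)]
  rw [invariantCyclesHoldFor_iff_forall_comap_le hf] at h
  intro p t'' s''
  exact comap_le_comap_baseChange_of_forall_exists hf g t'' s''
    (forall_exists_of_finrank_range_le hf g t'' (finrank_range_le_of_finrank_range_le hf g (hle p) t''))
    (h p (AlgPoints.map g t'') (AlgPoints.map g s''))

/-! ## §4 `S`-retracts: padding, fibre products, fibre squares -/

/-- **(1.1) DESCENDS ALONG `S`-RETRACTS**: for an `S`-retract `𝒳 ⟶σ 𝒴 ⟶π 𝒳` (`σ ≫ π = 𝟙`) of a compact pencil of abelian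
`d`-folds `f` inside a compact pencil of abelian `(r + d)`-folds `π ≫ f`, (1.1) for `π ≫ f` gives (1.1) for `f` (part XXXIII-a
`comap_le_comap_of_retract`, degree `2(p + r)` upstairs). FACT-FREE. [cite: Fulton1998, Prop. 1.7 and Thm. 6.2 (a)]
[cite: Abdulali1994FamiliesAV, (1.1) (p. 1122)] -/
theorem invariantCyclesHoldFor_of_retract {r : ℕ} {f : 𝒳 ⟶ S} {π : 𝒴 ⟶ 𝒳} {σ : 𝒳 ⟶ 𝒴} (hf : IsCompactAbelianPencil f d)
    (hF : IsCompactAbelianPencil (π ≫ f) (r + d)) (hσπ : σ ≫ π = 𝟙 𝒳) (h : InvariantCyclesHoldFor (π ≫ f) (r + d)) :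
    InvariantCyclesHoldFor f d := by
  haveI : IsProper S.hom := IsSmoothProjective.isProper_holds hf.isSmoothProjective_base
  rw [invariantCyclesHoldFor_iff_forall_comap_le hf]
  rw [invariantCyclesHoldFor_iff_forall_comap_le hF] at h
  exact fun p t s ↦ comap_le_comap_of_retract hf.isSmoothProjective_total hF.isSmoothProjective_total hf.isSmoothProjectiveFamily
    hF.isSmoothProjectiveFamily hσπ (h (p + r) t s)

/-- **(1.1) DESCENDS FROM THE PADDED PENCIL `B × 𝒳 ⟶ S`** (`B` an abelian variety; part XXXII `comap_le_comap_of_snd_comp'`).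
FACT-FREE. [cite: Fulton1998, Prop. 1.7 and Thm. 6.2 (a)] [cite: Abdulali1994FamiliesAV, (1.1) (p. 1122)] -/
theorem invariantCyclesHoldFor_of_snd_comp {f : 𝒳 ⟶ S} (hf : IsCompactAbelianPencil f d) (B : AbelianVariety ℂ)
    (h : InvariantCyclesHoldFor (snd B.X 𝒳 ≫ f) (B.dim + d)) : InvariantCyclesHoldFor f d := by
  rw [invariantCyclesHoldFor_iff_forall_comap_le hf]
  rw [invariantCyclesHoldFor_iff_forall_comap_le (isCompactAbelianPencil_snd_comp hf B)] at h
  exact fun p t s ↦ comap_le_comap_of_snd_comp' hf B (h (p + B.dim) t s)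

/-- **(1.1) DESCENDS FROM THE FIBRE PRODUCT `𝒴 ×_S 𝒳 ⟶ S`** of two compact abelian pencils over the same curve (part XXXIII-b
`comap_le_comap_of_familyPullback`). FACT-FREE. [cite: MumfordGIT, Thm. 6.14] [cite: Abdulali1994FamiliesAV, (1.1) (p. 1122)] -/
theorem invariantCyclesHoldFor_of_fibreProduct {g : 𝒴 ⟶ S} {f : 𝒳 ⟶ S} {d' : ℕ} (hg : IsCompactAbelianPencil g d')
    (hf : IsCompactAbelianPencil f d) (h : InvariantCyclesHoldFor (familyPullback.snd g f ≫ f) (d' + d)) :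
    InvariantCyclesHoldFor f d := by
  rw [invariantCyclesHoldFor_iff_forall_comap_le hf]
  rw [invariantCyclesHoldFor_iff_forall_comap_le (isCompactAbelianPencil_familyPullback_snd_comp hg hf)] at h
  exact fun p t s ↦ comap_le_comap_of_familyPullback hg hf (h (p + d') t s)

/-- **(1.1) DESCENDS FROM THE FIBRE SQUARE `𝒳 ×_S 𝒳 ⟶ S`** (abelian `2d`-folds; part XXXIII-b `comap_le_comap_of_square`).
FACT-FREE. [cite: MumfordGIT, Thm. 6.14] [cite: Abdulali1994FamiliesAV, (1.1) (p. 1122)] -/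
theorem invariantCyclesHoldFor_of_square {f : 𝒳 ⟶ S} (hf : IsCompactAbelianPencil f d)
    (h : InvariantCyclesHoldFor (familyPullback.snd f f ≫ f) (d + d)) : InvariantCyclesHoldFor f d :=
  invariantCyclesHoldFor_of_fibreProduct hf hf h

end Summit.HodgeConjecture.HodgeConjecture.Ring2.AbelianAll

end
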